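import Summits.BirchSwinnertonDyer.BirchSwinnertonDyer.Theorems.ByReductionTypeAtTwoAdditivePotMultConjATwoNarrowRoadKitLayerTwo
import Summits.BirchSwinnertonDyer.BirchSwinnertonDyer.Theorems.ByReductionTypeAtTwoOrdKatoHalfAtTwoIsoConjATwoOfNarrowRankLayerModels
import Literature.NumberTheory.NumberFields.TotPosUnitsModSqMonotone
import HarnessLib

/-!
# K4 crux `AdditiveRankZeroAtTwo` (19098), children C3″ `AdditivePotGoodLowerHalfAtTwo` (22617) / C1″ (22615): the NARROW RANK CERTIFICATE at ANY rung
# `m ≥ 1` for a TOTALLY REAL cubic point field, READ THROUGH THE EDGAR–MOLLIN–PETERSON DOOR on the CONCRETE LAYER MODELS `A_j = ℚ(θ) ⊔ ℚ_j ⊂ ℚ̄`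
# (`ℚ_j = ℚ(ζ_{2^{j+2}})⁺`, degree `3·2^j`): (A)₂ from FOUR elementary data — `h(A_m)`, `h(A_{m+1})` odd, `2^a ≤ #(U⁺/U²)(A_m)`,
# `2^b ≤ #sign(U_{A_{m+1}})` with `a + b = 3·2^{m+1}` (seat `bsd-2adic-k4-w2` GEN 15; `--supports stmt-BirchSwinnertonDyer-22617 --as helper`)

Cell `bsd-2adic`.  THEOREMS ONLY (no definition, no named fact, no `sorry`).  The general rung of the narrow rank certificate
(cruxlead-19573-w2 GEN 11, `NarrowRankRung.conjA_two_cubicModel_of_narrowRank_layer_models_eq`, p747405: for the cubic field `ℚ(β)` — Fukuda index `≤ 1`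
along every cyclotomic `ℤ₂`-extension — ONE equality `[Cl⁺(L') : Cl⁺(L')²] = [Cl⁺(L) : Cl⁺(L)²]` between CONCRETE models `L ≅ ℚ(β)_m`, `L' ≅ ℚ(β)_{m+1}` gives
(A)₂) composed with this seat's GEN 13 door `index_range_pow_two_narrowClassGroup_eq_of_bounds_of_le` (p750350: `F₁ ≤ F₂ ⊂ E`, `F₂` totally real, `h(F₁)`,
`h(F₂)` odd, `2^a ≤ #(U⁺/U²)(F₁)`, `2^b ≤ #sign(U_{F₂})`, `a + b = [F₂ : ℚ]` ⟹ the equality, `= 2^a`).  The models are the sup-fields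
`A_j := ℚ(θ) ⊔ (CyclotomicZp.zpExtension 2).layer j` inside `ℚ̄` — totally real of degree `3·2^j` for a totally real cubic `ℚ(θ)` (`layer_basics`, the
any-`j` form of k4-w3's `layer_two_basics` / k4-w1's `layer_two_basics_d316`), containing `t_j = ζ_{2^{j+2}} + ζ_{2^{j+2}}⁻¹`, a root of `Ψ_j`
(`Ψ_0 = X`, `Ψ_{j+1} = Ψ_j(X² − 2)`; tree `CyclotomicZp.exists_mem_layer_iterate_zpExtension`, cruxlead-19573-w2 GEN 11).

* §1 `layer_basics` — `A_n` is totally real, `[A_n : ℚ] = 3·2^n`, `[ℚ(θ) : ℚ] = 3` (any `n`; restricted cyclotomic `ℤ₂`-tower of the odd-degree field `ℚ(θ)`).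
* §2 ★ `conjA_two_cubicModel_of_narrowRank_layer_bounds` — `y² = x³ + px² + qx + r` (irreducible, root `β`), `ℚ(β) = ℚ(θ)` for a root `θ` of a totally real
  (irreducible, integer, monic) cubic, `m ≥ 1`, `a + b = 3·2^{m+1}`, and the four data `hK`, `hL`, `hlow`, `hsig` on `A_m`, `A_{m+1}` ⟹ (A)₂ for `⟨0, p, 0, q, r⟩`
  at every cyclotomic `κ`.  The rung `m = 2` (degrees `12 / 24`, letters EQUAL23 of a `bnfnarrow` census) is the case the four hLim2-ALONE `Δ > 0` rows
  `279440c1`, `293200be1`, `412992bw1`, `467928d1` of C1″/C3″ need (eng-2 CERT-NARROW6-E2 v1.3: all four data valued GRH-free).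

HONEST FRAMING (D-0036 / D-0054 / D-0152): a property of number fields is consumed, nothing is asserted about any field or curve; closes nothing at the
`∀`-level (C3″ 22617 / C1″ 22615 research-open); nothing booked (D-0054); BSD is not proved by any of this.

References: [EdgarMollinPeterson1986] Thm. 2.1; [FrohlichTaylor1990] Ch. V §1; [Fukuda1994] Thm. 1 (2); [Washington1997] §13.1 Prop. 13.2, Lemma 13.3;
[CoatesSujatha2005] Conj. A, Thm. 3.4.
-/

set_option autoImplicit false
-- sibling precedent (`…NarrowRoadKitLayerTwo.lean`): the directory name repeats the summit name
set_option linter.dupNamespace false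

noncomputable section

open scoped Classical IntermediateField NumberField Polynomial

namespace Summit.BirchSwinnertonDyer.BirchSwinnertonDyer.Theorems.AddKatoTwo

open Polynomial IsDedekindDomain NumberField Field IntermediateField
  Literature.NumberTheory.EllipticCurves Literature.NumberTheory.EllipticCurves.ZpExtension
  Literature.NumberTheory.IwasawaTheory Literature.NumberTheory.NumberFields
  Literature.NumberTheory.GaloisRepresentations Literature.Geometry.Kaehler.ComplexTorus
  Summit.BirchSwinnertonDyer.BirchSwinnertonDyer.Theorems.SteinbergFibreAtTwo

/-! ## §1 The sup-field `A_n = ℚ(θ) ⊔ ℚ_n` of a totally real cubic field: totally real of degree `3·2^n` -/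

section Basics

variable {p q r : ℤ} {θ : AlgebraicClosure ℚ}

set_option maxHeartbeats 400000 in
/-- **The basic data of `A_n = ℚ(θ) ⊔ ℚ_n` : totally real, degree `3·2^n`, and `[ℚ(θ):ℚ] = 3`** — from the restricted cyclotomic
`ℤ₂`-tower of `ℚ(θ)` (odd degree): its `n`-th layer is `≅ ℚ(θ) ⊔ ℚ_n`, totally real as a layer of a `ℤ₂`-extension of a totally real field, of
degree `3·2^n` (k4-w3's `layer_two_basics` with `2` replaced by `n`). [cite: Washington1997, §13.1 and Prop. 13.2] -/
theorem layer_basics (hirr : Irreducible (Cubic.toPoly ⟨1, (p : ℚ), q, r⟩))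
    (hθ : aeval θ (Cubic.toPoly ⟨1, (p : ℚ), q, r⟩) = 0)
    (hreal : haveI : FiniteDimensional ℚ ↥ℚ⟮θ⟯ :=
        IntermediateField.adjoin.finiteDimensional ⟨_, Cubic.monic_of_a_eq_one', by rwa [← aeval_def]⟩
      haveI : NumberField ↥ℚ⟮θ⟯ := NumberField.mk
      IsTotallyReal ↥ℚ⟮θ⟯) (n : ℕ) :
    haveI : FiniteDimensional ℚ ↥ℚ⟮θ⟯ :=
      IntermediateField.adjoin.finiteDimensional ⟨_, Cubic.monic_of_a_eq_one', by rwa [← aeval_def]⟩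
    haveI : FiniteDimensional ℚ ↥((CyclotomicZp.zpExtension 2).layer n) := (CyclotomicZp.zpExtension 2).finiteDimensional_layer_holds n
    haveI : NumberField ↥(ℚ⟮θ⟯ ⊔ (CyclotomicZp.zpExtension 2).layer n) := NumberField.mk
    IsTotallyReal ↥(ℚ⟮θ⟯ ⊔ (CyclotomicZp.zpExtension 2).layer n) ∧
      Module.finrank ℚ ↥(ℚ⟮θ⟯ ⊔ (CyclotomicZp.zpExtension 2).layer n) = 3 * 2 ^ n ∧ Module.finrank ℚ ↥ℚ⟮θ⟯ = 3 := by
  haveI : FiniteDimensional ℚ ↥ℚ⟮θ⟯ :=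
    IntermediateField.adjoin.finiteDimensional ⟨_, Cubic.monic_of_a_eq_one', by rwa [← aeval_def]⟩
  haveI : FiniteDimensional ℚ ↥((CyclotomicZp.zpExtension 2).layer n) := (CyclotomicZp.zpExtension 2).finiteDimensional_layer_holds n
  haveI : NumberField ↥ℚ⟮θ⟯ := NumberField.mk
  haveI : NumberField ↥(ℚ⟮θ⟯ ⊔ (CyclotomicZp.zpExtension 2).layer n) := NumberField.mk
  haveI : IsTotallyReal ↥ℚ⟮θ⟯ := hreal
  set κ := CyclotomicZp.zpExtension 2 with hκdef
  have h3 : Module.finrank ℚ ↥ℚ⟮θ⟯ = 3 := finrank_adjoin_eq_three_of_irreducible hirr hθ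
  have hodd3 : Odd (Module.finrank ℚ ↥ℚ⟮θ⟯) := by rw [h3]; decide
  have hsurj := surjective_comp_absGaloisRestrict_cyclotomicZp_of_odd ℚ⟮θ⟯ hodd3
  set κE := κ.restrict ↥ℚ⟮θ⟯ hsurj with hκE
  haveI : FiniteDimensional ↥ℚ⟮θ⟯ (κE.layer n) := κE.finiteDimensional_layer_holds n
  haveI : NumberField (κE.layer n) := NumberField.of_module_finite ↥ℚ⟮θ⟯ _
  obtain ⟨f⟩ := nonempty_algEquiv_layer_restrict_fieldRange_sup_layer κ ↥ℚ⟮θ⟯ hsurj (ℚ⟮θ⟯).val n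
  have hrange : (ℚ⟮θ⟯).val.fieldRange ⊔ κ.layer n = ℚ⟮θ⟯ ⊔ κ.layer n := by rw [fieldRange_val]
  set e : ↥(κE.layer n) ≃ₐ[ℚ] ↥(ℚ⟮θ⟯ ⊔ κ.layer n) := f.trans (equivOfEq hrange) with hedef
  haveI : IsTotallyReal ↥(κE.layer n) := isTotallyReal_layer κE n
  refine ⟨IsTotallyReal.ofRingEquiv e.toRingEquiv, ?_, h3⟩
  rw [← e.toLinearEquiv.finrank_eq, finrank_layer_restrict κ ↥ℚ⟮θ⟯ hsurj n, h3]

end Basics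

/-! ## §2 The door: (A)₂ at the rung `m` from the four Edgar–Mollin–Peterson data on `A_m`, `A_{m+1}` -/

section Door

variable {θ : AlgebraicClosure ℚ}

set_option maxHeartbeats 1600000 in
/-- ★ **(A) at `2` for `y² = x³ + px² + qx + r` from the narrow rank certificate at the rung `m ≥ 1`, read through the Edgar–Mollin–Peterson door on
the concrete layers `A_m = ℚ(θ) ⊔ ℚ_m`, `A_{m+1} = ℚ(θ) ⊔ ℚ_{m+1}`.**  Data: the curve cubic `⟨1, p, q, r⟩` irreducible with root `β`; a totally real
integer cubic `⟨1, p', q', r'⟩` irreducible with root `θ` and `ℚ(β) = ℚ(θ)` (change of generator to the point field's reduced model); `m ≥ 1`; `a + b = 3·2^{m+1}`;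
(hK) `h(A_m)` odd; (hL) `h(A_{m+1})` odd; (hlow) `2^a ≤ #(U⁺/U²)(A_m)` (`a` independent totally positive non-square unit classes); (hsig)
`2^b ≤ #sign(U_{A_{m+1}})` (`b` units with independent signatures).  Then `[Cl⁺(A_{m+1}) : (Cl⁺)²] = [Cl⁺(A_m) : (Cl⁺)²] (= 2^a)` (GEN 13 door
`index_range_pow_two_narrowClassGroup_eq_of_bounds_of_le`) and the concrete-model rung `conjA_two_cubicModel_of_narrowRank_layer_models_eq` (roots of `Ψ_m`,
`Ψ_{m+1}` from `CyclotomicZp.exists_mem_layer_iterate_zpExtension`, degrees from `layer_basics`) gives (A)₂ for `⟨0, p, 0, q, r⟩` at every cyclotomic `κ`.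
Nothing is asserted about any curve or field. [cite: EdgarMollinPeterson1986, Thm. 2.1, p. 34] [cite: Fukuda1994, Thm. 1 (2), p. 264]
[cite: Washington1997, §13.1 and Lemma 13.3] [cite: CoatesSujatha2005, Conj. A and Thm. 3.4] -/
theorem conjA_two_cubicModel_of_narrowRank_layer_bounds (p q r : ℤ)
    [((⟨0, (p : ℚ), 0, (q : ℚ), (r : ℚ)⟩ : WeierstrassCurve ℚ)).IsElliptic]
    (hirr : Irreducible (Cubic.toPoly ⟨1, (p : ℚ), q, r⟩))
    {β : AlgebraicClosure ℚ} (hβ : aeval β (Cubic.toPoly ⟨1, (p : ℚ), q, r⟩) = 0)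
    {p' q' r' : ℤ} (hirr' : Irreducible (Cubic.toPoly ⟨1, (p' : ℚ), q', r'⟩))
    (hθ : aeval θ (Cubic.toPoly ⟨1, (p' : ℚ), q', r'⟩) = 0) (hadj : ℚ⟮β⟯ = ℚ⟮θ⟯)
    (hreal : haveI : FiniteDimensional ℚ ↥ℚ⟮θ⟯ :=
        IntermediateField.adjoin.finiteDimensional ⟨_, Cubic.monic_of_a_eq_one', by rwa [← aeval_def]⟩
      haveI : NumberField ↥ℚ⟮θ⟯ := NumberField.mk
      IsTotallyReal ↥ℚ⟮θ⟯)
    (m : ℕ) (hm : 1 ≤ m) {a b : ℕ} (hab : a + b = 3 * 2 ^ (m + 1))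
    (hK : ∀ [NumberField ↥(ℚ⟮θ⟯ ⊔ (CyclotomicZp.zpExtension 2).layer m)],
      Odd (classNumber ↥(ℚ⟮θ⟯ ⊔ (CyclotomicZp.zpExtension 2).layer m)))
    (hL : ∀ [NumberField ↥(ℚ⟮θ⟯ ⊔ (CyclotomicZp.zpExtension 2).layer (m + 1))],
      Odd (classNumber ↥(ℚ⟮θ⟯ ⊔ (CyclotomicZp.zpExtension 2).layer (m + 1))))
    (hlow : ∀ [NumberField ↥(ℚ⟮θ⟯ ⊔ (CyclotomicZp.zpExtension 2).layer m)],
      2 ^ a ≤ Nat.card (TotPosUnitsModSq ↥(ℚ⟮θ⟯ ⊔ (CyclotomicZp.zpExtension 2).layer m)))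
    (hsig : ∀ [NumberField ↥(ℚ⟮θ⟯ ⊔ (CyclotomicZp.zpExtension 2).layer (m + 1))],
      2 ^ b ≤ Nat.card (Set.range (signVec (K := ↥(ℚ⟮θ⟯ ⊔ (CyclotomicZp.zpExtension 2).layer (m + 1))))))
    (κ : ZpExtension ℚ 2) (hκ : κ.IsCyclotomic) :
    ∃ (γ : absoluteGaloisGroup ℚ) (Dd : ((⟨0, (p : ℚ), 0, (q : ℚ), (r : ℚ)⟩ : WeierstrassCurve ℚ)).FineSelmerDualData κ γ),
      Module.Finite ℤ_[2] (RestrictScalars ℤ_[2] (IwasawaAlgebra 2) Dd.X) := by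
  haveI : FiniteDimensional ℚ ↥ℚ⟮θ⟯ :=
    IntermediateField.adjoin.finiteDimensional ⟨_, Cubic.monic_of_a_eq_one', by rwa [← aeval_def]⟩
  haveI : FiniteDimensional ℚ ↥((CyclotomicZp.zpExtension 2).layer m) := (CyclotomicZp.zpExtension 2).finiteDimensional_layer_holds m
  haveI : FiniteDimensional ℚ ↥((CyclotomicZp.zpExtension 2).layer (m + 1)) :=
    (CyclotomicZp.zpExtension 2).finiteDimensional_layer_holds (m + 1)
  haveI : NumberField ↥ℚ⟮θ⟯ := NumberField.mk
  haveI : NumberField ↥(ℚ⟮θ⟯ ⊔ (CyclotomicZp.zpExtension 2).layer m) := NumberField.mk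
  haveI : NumberField ↥(ℚ⟮θ⟯ ⊔ (CyclotomicZp.zpExtension 2).layer (m + 1)) := NumberField.mk
  obtain ⟨-, hfin1, h3⟩ := layer_basics hirr' hθ hreal m
  obtain ⟨hreal2, hfin2, -⟩ := layer_basics hirr' hθ hreal (m + 1)
  haveI := hreal2
  -- the tower `ℚ(β) = ℚ(θ) ≤ A_m ≤ A_{m+1}`
  have h12 : ℚ⟮θ⟯ ⊔ (CyclotomicZp.zpExtension 2).layer m ≤ ℚ⟮θ⟯ ⊔ (CyclotomicZp.zpExtension 2).layer (m + 1) :=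
    sup_le_sup_left ((CyclotomicZp.zpExtension 2).layer_mono (Nat.le_succ m)) _
  have hβ1 : ℚ⟮β⟯ ≤ ℚ⟮θ⟯ ⊔ (CyclotomicZp.zpExtension 2).layer m := hadj.le.trans le_sup_left
  have hβ2 : ℚ⟮β⟯ ≤ ℚ⟮θ⟯ ⊔ (CyclotomicZp.zpExtension 2).layer (m + 1) := hadj.le.trans le_sup_left
  haveI : NumberField ↥ℚ⟮β⟯ := by rw [hadj]; infer_instance
  have h3β : Module.finrank ℚ ↥ℚ⟮β⟯ = 3 := by rw [hadj]; exact h3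
  letI : Algebra ↥ℚ⟮β⟯ ↥(ℚ⟮θ⟯ ⊔ (CyclotomicZp.zpExtension 2).layer m) := (IntermediateField.inclusion hβ1).toRingHom.toAlgebra
  letI : Algebra ↥ℚ⟮β⟯ ↥(ℚ⟮θ⟯ ⊔ (CyclotomicZp.zpExtension 2).layer (m + 1)) := (IntermediateField.inclusion hβ2).toRingHom.toAlgebra
  haveI : IsScalarTower ℚ ↥ℚ⟮β⟯ ↥(ℚ⟮θ⟯ ⊔ (CyclotomicZp.zpExtension 2).layer m) :=
    IsScalarTower.of_algebraMap_eq fun x => ((IntermediateField.inclusion hβ1).commutes x).symm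
  haveI : IsScalarTower ℚ ↥ℚ⟮β⟯ ↥(ℚ⟮θ⟯ ⊔ (CyclotomicZp.zpExtension 2).layer (m + 1)) :=
    IsScalarTower.of_algebraMap_eq fun x => ((IntermediateField.inclusion hβ2).commutes x).symm
  haveI : Module.Finite ↥ℚ⟮β⟯ ↥(ℚ⟮θ⟯ ⊔ (CyclotomicZp.zpExtension 2).layer m) := Module.Finite.of_restrictScalars_finite ℚ _ _
  haveI : Module.Finite ↥ℚ⟮β⟯ ↥(ℚ⟮θ⟯ ⊔ (CyclotomicZp.zpExtension 2).layer (m + 1)) := Module.Finite.of_restrictScalars_finite ℚ _ _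
  have hL1 : Module.finrank ↥ℚ⟮β⟯ ↥(ℚ⟮θ⟯ ⊔ (CyclotomicZp.zpExtension 2).layer m) = 2 ^ m := by
    have htower := Module.finrank_mul_finrank ℚ ↥ℚ⟮β⟯ ↥(ℚ⟮θ⟯ ⊔ (CyclotomicZp.zpExtension 2).layer m)
    rw [h3β, hfin1] at htower
    omega
  have hL2 : Module.finrank ↥ℚ⟮β⟯ ↥(ℚ⟮θ⟯ ⊔ (CyclotomicZp.zpExtension 2).layer (m + 1)) = 2 ^ (m + 1) := by
    have htower := Module.finrank_mul_finrank ℚ ↥ℚ⟮β⟯ ↥(ℚ⟮θ⟯ ⊔ (CyclotomicZp.zpExtension 2).layer (m + 1))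
    rw [h3β, hfin2] at htower
    omega
  -- roots of `Ψ_m`, `Ψ_{m+1}` in the models
  obtain ⟨t₁, ht₁, ht₁0⟩ := CyclotomicZp.exists_mem_layer_iterate_zpExtension m
  obtain ⟨t₂, ht₂, ht₂0⟩ := CyclotomicZp.exists_mem_layer_iterate_zpExtension (m + 1)
  have ht₁A : t₁ ∈ ℚ⟮θ⟯ ⊔ (CyclotomicZp.zpExtension 2).layer m := (le_sup_right : (CyclotomicZp.zpExtension 2).layer m ≤ _) ht₁
  have ht₂A : t₂ ∈ ℚ⟮θ⟯ ⊔ (CyclotomicZp.zpExtension 2).layer (m + 1) :=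
    (le_sup_right : (CyclotomicZp.zpExtension 2).layer (m + 1) ≤ _) ht₂
  have ht₁' : (fun x : ↥(ℚ⟮θ⟯ ⊔ (CyclotomicZp.zpExtension 2).layer m) => x ^ 2 - 2)^[m]
      (⟨t₁, ht₁A⟩ : ↥(ℚ⟮θ⟯ ⊔ (CyclotomicZp.zpExtension 2).layer m)) = 0 := by
    apply (algebraMap ↥(ℚ⟮θ⟯ ⊔ (CyclotomicZp.zpExtension 2).layer m) (AlgebraicClosure ℚ)).injective
    rw [NestedSqrtTwo.map_iterate, map_zero]
    exact ht₁0
  have ht₂' : (fun x : ↥(ℚ⟮θ⟯ ⊔ (CyclotomicZp.zpExtension 2).layer (m + 1)) => x ^ 2 - 2)^[m + 1]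
      (⟨t₂, ht₂A⟩ : ↥(ℚ⟮θ⟯ ⊔ (CyclotomicZp.zpExtension 2).layer (m + 1))) = 0 := by
    apply (algebraMap ↥(ℚ⟮θ⟯ ⊔ (CyclotomicZp.zpExtension 2).layer (m + 1)) (AlgebraicClosure ℚ)).injective
    rw [NestedSqrtTwo.map_iterate, map_zero]
    exact ht₂0
  -- the Edgar–Mollin–Peterson door
  have hab' : a + b = Module.finrank ℚ ↥(ℚ⟮θ⟯ ⊔ (CyclotomicZp.zpExtension 2).layer (m + 1)) := by rw [hfin2, hab]
  have hr := (index_range_pow_two_narrowClassGroup_eq_of_bounds_of_le h12 hK hL hab' hlow hsig).1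
  exact NarrowRankRung.conjA_two_cubicModel_of_narrowRank_layer_models_eq p q r hirr hβ m hm
    ↥(ℚ⟮θ⟯ ⊔ (CyclotomicZp.zpExtension 2).layer m) hL1 _ ht₁'
    ↥(ℚ⟮θ⟯ ⊔ (CyclotomicZp.zpExtension 2).layer (m + 1)) hL2 _ ht₂' hr κ hκ

end Door

end Summit.BirchSwinnertonDyer.BirchSwinnertonDyer.Theorems.AddKatoTwo

end
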